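import Summits.QuantumFields.BalabanUV.Beta.FP.TowerLawFullIndex
import Summits.QuantumFields.BalabanUV.Beta.FP.KernelPeriodisationFibHessKerTower

/-!
# `BalabanUV.Beta.FP.TowerKernelLaw` — road «FP» for binder row D1, ROUTE T, SPEC #42 (4) «DE-PERIODISATION»: **THE TOWER's ONE-LOOP KERNEL LAW ON THE
# LATTICE** — #41d `TowerLawFullIndex.hessT_fullIndex_law_tower` AT EVERY BOX `M′ K` of a growing `Lc`-divisible box sequence, COMPOSED BY ONE TERM with
# leaf-06's (P2‴)-on-the-tower `KernelPeriodisationFibHessKerTower.hessKer_law_of_tower_hessT_law_coDress`: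
# `hessKer A_N 𝒱_N 𝒲_N μ ν z = hessKer A_F 𝒱_F 𝒲_F μ ν z + hessKer (Π̂ᵀ(KInvStep Lc (lev 0))Π̂ @ rs 0) 𝒱_G 𝒲_G μ ν z` on `ℤ^(d+1)` —
# one instance per tower depth `n` of the hypothesis `hlaw` of #28 §4 `stepRecursion_of_hessKer_laws` (under R-D1-g49-1 (ii) the whole ladder `j ≥ 1`,
# depth `n = 0` serving `j = 1`), modulo the (C1) namings and the identifications (L2′)

WHAT IS DISPLAYED.  (i) #41d's binders AT EVERY BOX `K : ℕ` (its direction-free pins `H₀ Q₁₀ τ₁ τ₂ Q₂₀ W₀ P Dbar Γ I L S 𝔔₀`, its direction module `V K`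
with `hv lv Xbf`, its jets ∕ namings ∕ generator jets as functions of the direction, #21's rows `uTop hH₁t hH₂t a1 a2 c1 c2 d1 d2 ∀ v`, the two one-shot right
inverses `XN XF` with their LEGS over the chart kernels `A_N A_F` under the torus rules) — the box-free data shared: `Lc lev rs n c`, the multipliers' and the
charts' blockings `ρN LNc ρF LFc`, the lattice chart kernels `A_N A_F`; (ii) (P2‴)'s lattice letters: the box sequence grows (`hM′gr`) and is `Lc`-divisible
(`hM′`), `A_N` decays and is blocking-`Lc^(n+2)` covariant, `A_F` decays and is blocking-`Lc^(n+1)` covariant (an2's composite one-shot charts'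
`tower_shiftK_A` shape), the six lattice base-point jets `𝒱_X (μ,0)`, `𝒱_X (ν,z)`, `𝒲_X (μ,0;ν,z)` are bi-localised; (iii) THE (C1) NAMINGS AS HYPOTHESES,
PER BOX: the periodised lattice jets `perF (T K) (dper (T K) (𝒱_X …))` (`T K = towerTorus Lc (M′ K) (n+1)` for `N`, `F`; `M′ K` for `G`) carry #39's parities
(multiplier–multiplier blocks vanish; SYMMETRIC twin at order 1, ANTI at order 2) and their field ∕ multiplier blocks ARE the door's jets in two direction
labels `a₁ a₂` of a box-free label type `σ` read through `dv K : σ → V K` (G's H-blocks carrying the unit `∏_{i<n+1} wVH d Lc (lev i)`, #41d).  NOTHING is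
named here: which lattice jets, which charts and which directions realise these hypotheses is an2's (C1) (`CompositeOneShotChart`, SPEC S-an2-g49-1) and
leaf-02's (`TorusCompositeInsertionKernel`-type junctions) business at the record.
CONCLUSION: `hessKer AN 𝒱N 𝒲N μ ν z = hessKer AF 𝒱F 𝒲F μ ν z + hessKer (coDressKBmAt (toSite (rs 0)) Lc (KInvStep Lc (lev 0))) 𝒱G 𝒲G μ ν z`.
PROOF: ONE term — leaf-06 §3 (the `G` leg's decay ∕ covariance are an2's `decays_coDressKBmAt_KInvStep ∕ shiftK_coDressKBmAt_KInvStep` inside it; the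
tower's growth and the three period-lattice invariances inside its §1–§2) at `hlaw K :=` #41d at box `M′ K` with the (S3-2) torus jets SUBSTITUTED by the
periodised lattice jets.  [folklore] composition BY NAME; no `def`, no `def … : Prop`, nothing cited, 0 sorry; generated from #41d's tree bytes by
`HOME/b2b-balaban-beta-d1-p3/g28/w42a/gen42a.py` (the binder block indexed by `K`, token-exact).  The rows, the one-shot legs, the decay ∕ bi-localisation
letters and the namings are HYPOTHESES (nothing of the dictionary ∕ Bałaban's asserted).  NOT HERE: the identifications (L2′) `𝒦N j = TshotOf (j+1)`,
`𝒦F j = Lc⁸·dressedEntry …`, `𝒦G j = TbalOf j` — they WAIT on an2's (TAB_j) (R-D1-g49-2: the presentation fork's table half; Engine C R-AN2-49-PRESTAB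
decides (α)∕(β) at level 0) —, the (C1) namings, the END (#28 §4).

HONEST DEPENDENCY (page 1, mandatory): continuum YM on T⁴ ⇐ BetaPertH ∧ nine spine estimates (0/9 proved); BetaPertH ⇐ (D1) ∧ (D4) ∧ CAP+tail;
G-an2-4 gates asym, D1 and NE2/3/4.  HONEST FRAMING (cell contract, verbatim): «discharging `BetaPertH` makes Bałaban's UV stability UNCONDITIONAL —
a real constructive-QFT result; it is NOT the continuum limit and NOT the Clay problem.»  ABSOLUTE RULE (cell charter, verbatim): «No internally-minted
statement may enter as a cited fact. Every hypothesis is either kernel-proved in this package or a verbatim quotation of a PUBLISHED theorem with page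
reference. The manuscript(s) under audit are NOT citable for their own disputed steps — they are the thing under adjudication; programme-internal
(2001/route/tribunal) claims are never citable.»  0 estimates; 0∕4 row-D1 binders (hW, hR, D1Tel, D1Rep — `D1Tel` CONCLUDED only from displayed rows);
NOT (C1), NOT (T-ID), NOT SDF, NOT D1, NOT BetaPertH, NOT continuum, NOT Clay.  Road «FP» OWNER, b2b-balaban-beta-d1-p3 gen 28, 2026-08-23.  No existing file touched.
-/

noncomputable section

open scoped BigOperators Matrix

namespace Summit.QuantumFields.BalabanUV.Beta.FP.TowerKernelLaw

open Matrix Finset Filter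
open Literature.Probability.LatticeModels (Torus.proj)
open Literature.MathematicalPhysics.QuantumFieldTheory.Balaban1983to89
open Literature.MathematicalPhysics.QuantumFieldTheory.Balaban1983to89.Beta
open Literature.MathematicalPhysics.QuantumFieldTheory.Balaban1983to89.Beta.Composition (kkt)
open Literature.MathematicalPhysics.QuantumFieldTheory.Balaban1983to89.Beta.CompositionSingular (effForm flucCov minOp minOpL)
open B5Prop11Plancherel (fine)
open B6Lemma24Torus (pbox mem_pbox)
open AffineAveraging (Site box toSite unitVec)
open OneStepResolventKernel (Fib)
open OneStepKernelFamily (KInvStep)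
open ExpKernelCalculus (MKer Decays BiLoc shiftK hessKer)
open BalabanStepJetsSucc (wVH)
open Summit.QuantumFields.BalabanUV.Beta.AxialDressingRooted (axEc coDressKBmAt)
open Summit.QuantumFields.BalabanUV.Beta.BorderedHessian (bhKStepAt stepScale)
open Summit.QuantumFields.BalabanUV.Beta.D1BFx.LogDetSecondVariation (secondVar)
open Summit.QuantumFields.BalabanUV.Beta.D1BFx.MixedVarPackedHess (hessT)
open Summit.QuantumFields.BalabanUV.Beta.FP.KernelPeriodisationFib (Idx perF)
open Summit.QuantumFields.BalabanUV.Beta.FP.KernelPeriodisationFibLoc (dper)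
open Summit.QuantumFields.BalabanUV.Beta.FP.TorusCombRows (Res combRowsT)
open Summit.QuantumFields.BalabanUV.Beta.FP.TorusCompositeObjects (towerTorus compRows NParam combF bigP towerGen)
open Summit.QuantumFields.BalabanUV.Beta.FP.TorusCompositeFP (evalN)
open Summit.QuantumFields.BalabanUV.Beta.FP.TorusGaugeCovariance (tgrad)
open Summit.QuantumFields.BalabanUV.Beta.GAN24.FineReadoutCauchyFrame (toSite_mem_range)
open Summit.QuantumFields.BalabanUV.Beta.FP.TowerLawFullIndex (hessT_fullIndex_law_tower)
open Summit.QuantumFields.BalabanUV.Beta.FP.KernelPeriodisationFibHessKerTower (hessKer_law_of_tower_hessT_law_coDress)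

variable {d : ℕ}

section Law

variable (Lc : ℕ) [NeZero Lc] (M' : ℕ → (Fin (d + 1) → ℕ)) [∀ K μ, NeZero (M' K μ)] (lev : ℕ → ℕ) (rs : ℕ → (Fin (d + 1) → ℕ)) (n : ℕ)

set_option synthInstance.maxSize 1024 in
/-- [folklore] **THE TOWER's ONE-LOOP KERNEL LAW ON THE LATTICE** (SPEC #42 (4); one instance per tower depth `n` — the ladder `j ≥ 1` of #28 §4 under
R-D1-g49-1 (ii)).  A growing (`hM′gr`)
`Lc`-divisible (`hM′`) box sequence `M′ K`; #41d `hessT_fullIndex_law_tower`'s binders AT EVERY BOX `K` (box-free data shared), its (S3-2) torus jets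
SUBSTITUTED by the periodisations `perF (T K) (dper (T K) (𝒱_X …))` of six lattice base-point jets (the (C1) namings as hypotheses: parities + the
door's jets on the blocks, per box); (P2‴)'s lattice letters (decay + blocking covariance of `A_N A_F`, bi-localisation of the jets) ⊢
`hessKer AN 𝒱N 𝒲N μ ν z = hessKer AF 𝒱F 𝒲F μ ν z + hessKer (coDressKBmAt (toSite (rs 0)) Lc (KInvStep Lc (lev 0))) 𝒱G 𝒲G μ ν z`.
Proof: ONE term of leaf-06 `hessKer_law_of_tower_hessT_law_coDress` at `hlaw K :=` #41d at box `M′ K`. -/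
theorem hessKer_law_tower (hM'gr : ∀ N : ℕ, ∀ᶠ K in atTop, ∀ i, N ≤ M' K i) (hrs : ∀ k, rs k ∈ box (d + 1) Lc) (hlev : ∀ i, lev i = lev (i + 1) + 1)
    -- (P2‴)'s lattice base-point jets of the three systems (fibre `Fib d`), and the base points
    (𝒱N 𝒱F 𝒱G : Fin (d + 1) → (Fin (d + 1) → ℤ) → MKer (d + 1) (Fib d))
    (𝒲N 𝒲F 𝒲G : Fin (d + 1) → (Fin (d + 1) → ℤ) → Fin (d + 1) → (Fin (d + 1) → ℤ) → MKer (d + 1) (Fib d))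
    (μ ν : Fin (d + 1)) (z : Fin (d + 1) → ℤ)
    -- #41d's binders AT EVERY BOX `K` (generated from the tree bytes; `X ↦ X K` for every box-dependent binder `X`, `M′ ↦ M′ K`)
    (hM' : ∀ K : ℕ, ∀ i, Lc ∣ (M' K) i)
    -- the top multipliers' slot presentation (#21 VERBATIM)
    {κ : ℕ → Type*}
    [∀ K : ℕ, Fintype (κ K)]
    [∀ K : ℕ, DecidableEq (κ K)]
    (pμ' : ∀ K : ℕ, (κ K) → ↥(pbox (M' K)))
    (mμ' : ∀ K : ℕ, (κ K) → Fin (d + 1))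
    (hfμ' : ∀ K : ℕ, Function.Injective (fun a : (κ K) => (((pμ' K) a, Sum.inr ((mμ' K) a)) : Idx (M' K) (Fib d))))
    (hcoarse' : ∀ K : ℕ, ∀ (s : ↥(pbox (M' K))) (m : Fin (d + 1)),
      ((s, Sum.inr m) : Idx (M' K) (Fib d)) ∈ Set.range (fun a : (κ K) => (((pμ' K) a, Sum.inr ((mμ' K) a)) : Idx (M' K) (Fib d))) ↔ Torus.proj Lc (s : Site (d + 1)) = 0)
    -- the composite objects of record, PINNED (#21 VERBATIM)
    {H₀ : ∀ K : ℕ, Matrix (↥(pbox (towerTorus Lc (M' K) (n + 1))) × Fin (d + 1)) (↥(pbox (towerTorus Lc (M' K) (n + 1))) × Fin (d + 1)) ℝ}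
    {Q₁₀ : ∀ K : ℕ, Matrix (↥(pbox (M' K)) × Fin (d + 1)) (↥(pbox (towerTorus Lc (M' K) (n + 1))) × Fin (d + 1)) ℝ}
    {τ₁ : ∀ K : ℕ, Matrix (NParam Lc (fine Lc (M' K)) (fun k => rs (k + 1)) n) (↥(pbox (towerTorus Lc (M' K) (n + 1))) × Fin (d + 1)) ℝ}
    (hH₀ : ∀ K : ℕ, (H₀ K) = (perF (towerTorus Lc (M' K) (n + 1)) (bhKStepAt d (toSite (rs (n + 1))) Lc (lev (n + 1)))).submatrix
        (fun b : (↥(pbox (towerTorus Lc (M' K) (n + 1))) × Fin (d + 1)) => ((b.1, Sum.inl b.2) : Idx (towerTorus Lc (M' K) (n + 1)) (Fib d)))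
        (fun b : (↥(pbox (towerTorus Lc (M' K) (n + 1))) × Fin (d + 1)) => ((b.1, Sum.inl b.2) : Idx (towerTorus Lc (M' K) (n + 1)) (Fib d))))
    (hQ₁₀ : ∀ K : ℕ, (Q₁₀ K) = compRows Lc (M' K) lev rs (n + 1))
    (hτ₁ : ∀ K : ℕ, (τ₁ K) = bigP Lc (fine Lc (M' K)) (fun k => rs (k + 1)) (fun k => toSite_mem_range (hrs (k + 1))) n)
    {τ₂ : ∀ K : ℕ, Matrix (Res (toSite (rs 0)) Lc (M' K)) (↥(pbox (M' K)) × Fin (d + 1)) ℝ}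
    (hτ₂ : ∀ K : ℕ, (τ₂ K) = combF Lc (M' K) (rs 0))
    {Q₂₀ : ∀ K : ℕ, Matrix (κ K) (↥(pbox (M' K)) × Fin (d + 1)) ℝ}
    (hQ₂₀ : ∀ K : ℕ, (Q₂₀ K) = (perF (M' K) (bhKStepAt d (toSite (rs 0)) Lc (lev 0))).submatrix (fun a : (κ K) => (((pμ' K) a, Sum.inr ((mμ' K) a)) : Idx (M' K) (Fib d)))
        (fun b : (↥(pbox (M' K)) × Fin (d + 1)) => ((b.1, Sum.inl b.2) : Idx (M' K) (Fib d))))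
    {W₀ : ∀ K : ℕ, Matrix (↥(pbox (towerTorus Lc (M' K) (n + 1))) × Fin (d + 1)) (NParam Lc (M' K) rs (n + 1)) ℝ}
    (hW₀ : ∀ K : ℕ, (W₀ K) = towerGen Lc (M' K) rs (n + 1))
    {P : ∀ K : ℕ, Matrix (NParam Lc (M' K) rs (n + 1)) (↥(pbox (towerTorus Lc (M' K) (n + 1))) × Fin (d + 1)) ℝ}
    (hP : ∀ K : ℕ, (P K) = bigP Lc (M' K) rs (fun k => toSite_mem_range (hrs k)) (n + 1))
    -- the step constant of the chart transport (#21's `c`), the (COV-m) order-0 image PINNED, the one-shot resolvent words and `𝔔₀` NAMED (#21 VERBATIM)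
    (c : ℝ)
    {Dbar : ∀ K : ℕ, Matrix (↥(pbox (M' K)) × Fin (d + 1)) (Res (toSite (rs 0)) Lc (M' K)) ℝ}
    (hDbar : ∀ K : ℕ, (Dbar K) = (∏ i ∈ range (n + 1), (stepScale d Lc (lev (i + 1)) * ((box (d + 1) Lc).card : ℝ))) •
        (tgrad (M' K)).submatrix (fun a : (↥(pbox (M' K)) × Fin (d + 1)) => ((a.1, Sum.inl a.2) : Idx (M' K) (Fib d))) (fun t : (Res (toSite (rs 0)) Lc (M' K)) => (t.1 : ↥(pbox (M' K)))))
    {Γ : ∀ K : ℕ, Matrix (↥(pbox (towerTorus Lc (M' K) (n + 1))) × Fin (d + 1)) (↥(pbox (towerTorus Lc (M' K) (n + 1))) × Fin (d + 1)) ℝ}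
    {I : ∀ K : ℕ, Matrix (↥(pbox (towerTorus Lc (M' K) (n + 1))) × Fin (d + 1)) ((↥(pbox (M' K)) × Fin (d + 1)) ⊕ (NParam Lc (fine Lc (M' K)) (fun k => rs (k + 1)) n)) ℝ}
    {L : ∀ K : ℕ, Matrix ((↥(pbox (M' K)) × Fin (d + 1)) ⊕ (NParam Lc (fine Lc (M' K)) (fun k => rs (k + 1)) n)) (↥(pbox (towerTorus Lc (M' K) (n + 1))) × Fin (d + 1)) ℝ}
    {S : ∀ K : ℕ, Matrix ((↥(pbox (M' K)) × Fin (d + 1)) ⊕ (NParam Lc (fine Lc (M' K)) (fun k => rs (k + 1)) n)) ((↥(pbox (M' K)) × Fin (d + 1)) ⊕ (NParam Lc (fine Lc (M' K)) (fun k => rs (k + 1)) n)) ℝ}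
    (hΓ : ∀ K : ℕ, flucCov (H₀ K) (fromRows (Q₁₀ K) (τ₁ K)) = (Γ K))
    (hI : ∀ K : ℕ, minOp (H₀ K) (fromRows (Q₁₀ K) (τ₁ K)) = (I K))
    (hL : ∀ K : ℕ, minOpL (H₀ K) (fromRows (Q₁₀ K) (τ₁ K)) = (L K))
    (hS : ∀ K : ℕ, effForm (H₀ K) (fromRows (Q₁₀ K) (τ₁ K)) = (S K))
    {𝔔₀ : ∀ K : ℕ, Matrix (κ K) (↥(pbox (towerTorus Lc (M' K) (n + 1))) × Fin (d + 1)) ℝ}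
    (h𝔔₀ : ∀ K : ℕ, (Q₂₀ K) * (Q₁₀ K) = (𝔔₀ K))
    -- the direction module and its DISPLAYED read-outs: finest-level direction `h := hv v` (enters only the rows and the generator jets — no linearity
    -- needed here: the jets' (bi)linearity is displayed; at the record it follows from `hv`'s), tree-gauge parameter `λ := lv v` and top generator
    -- `X̄ := Xbf v` (LINEAR: they enter the one-shot namings `k1 k2 q1 q2`)
    {V : ℕ → Type*}
    [∀ K : ℕ, AddCommGroup (V K)]
    [∀ K : ℕ, Module ℝ (V K)]
    (hv : ∀ K : ℕ, (V K) → ((↥(pbox (towerTorus Lc (M' K) (n + 1))) × Fin (d + 1)) → ℝ))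
    (lv : ∀ K : ℕ, (V K) → (↥(pbox (towerTorus Lc (M' K) (n + 1))) → ℝ))
    (hlv : ∀ K : ℕ, ∀ (r : ℝ) (x y : (V K)), (lv K) (r • x + y) = r • (lv K) x + (lv K) y)
    (Xbf : ∀ K : ℕ, (V K) → Matrix (κ K) (κ K) ℝ)
    (hXbf : ∀ K : ℕ, ∀ (r : ℝ) (x y : (V K)), (Xbf K) (r • x + y) = r • (Xbf K) x + (Xbf K) y)
    -- #21's displayed jets AS FUNCTIONS of the direction: first order linear, second order in two slots (linear in each; the door reads the diagonal)
    (H₁f : ∀ K : ℕ, (V K) → Matrix (↥(pbox (towerTorus Lc (M' K) (n + 1))) × Fin (d + 1)) (↥(pbox (towerTorus Lc (M' K) (n + 1))) × Fin (d + 1)) ℝ)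
    (hH₁l : ∀ K : ℕ, ∀ (r : ℝ) (x y : (V K)), (H₁f K) (r • x + y) = r • (H₁f K) x + (H₁f K) y)
    (Q₁₁f : ∀ K : ℕ, (V K) → Matrix (↥(pbox (M' K)) × Fin (d + 1)) (↥(pbox (towerTorus Lc (M' K) (n + 1))) × Fin (d + 1)) ℝ)
    (hQ₁₁l : ∀ K : ℕ, ∀ (r : ℝ) (x y : (V K)), (Q₁₁f K) (r • x + y) = r • (Q₁₁f K) x + (Q₁₁f K) y)
    (Q₂₁f : ∀ K : ℕ, (V K) → Matrix (κ K) (↥(pbox (M' K)) × Fin (d + 1)) ℝ)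
    (hQ₂₁l : ∀ K : ℕ, ∀ (r : ℝ) (x y : (V K)), (Q₂₁f K) (r • x + y) = r • (Q₂₁f K) x + (Q₂₁f K) y)
    (H₂f : ∀ K : ℕ, (V K) → (V K) → Matrix (↥(pbox (towerTorus Lc (M' K) (n + 1))) × Fin (d + 1)) (↥(pbox (towerTorus Lc (M' K) (n + 1))) × Fin (d + 1)) ℝ)
    (hH₂l : ∀ K : ℕ, ∀ (r : ℝ) (x y z : (V K)), (H₂f K) (r • x + y) z = r • (H₂f K) x z + (H₂f K) y z)
    (hH₂r : ∀ K : ℕ, ∀ (r : ℝ) (x y z : (V K)), (H₂f K) z (r • x + y) = r • (H₂f K) z x + (H₂f K) z y)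
    (Q₁₂f : ∀ K : ℕ, (V K) → (V K) → Matrix (↥(pbox (M' K)) × Fin (d + 1)) (↥(pbox (towerTorus Lc (M' K) (n + 1))) × Fin (d + 1)) ℝ)
    (hQ₁₂l : ∀ K : ℕ, ∀ (r : ℝ) (x y z : (V K)), (Q₁₂f K) (r • x + y) z = r • (Q₁₂f K) x z + (Q₁₂f K) y z)
    (hQ₁₂r : ∀ K : ℕ, ∀ (r : ℝ) (x y z : (V K)), (Q₁₂f K) z (r • x + y) = r • (Q₁₂f K) z x + (Q₁₂f K) z y)
    (Q₂₂f : ∀ K : ℕ, (V K) → (V K) → Matrix (κ K) (↥(pbox (M' K)) × Fin (d + 1)) ℝ)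
    (hQ₂₂l : ∀ K : ℕ, ∀ (r : ℝ) (x y z : (V K)), (Q₂₂f K) (r • x + y) z = r • (Q₂₂f K) x z + (Q₂₂f K) y z)
    (hQ₂₂r : ∀ K : ℕ, ∀ (r : ℝ) (x y z : (V K)), (Q₂₂f K) z (r • x + y) = r • (Q₂₂f K) z x + (Q₂₂f K) z y)
    -- #21's composite and one-shot NAMINGS as functions (`h𝔔₁ h𝔔₂ k1 k2 q1 q2`; `X := −(c • diagonal (λ ∘ pr))` at `λ := lv v`; order 2 in two slots)
    (𝔔₁f : ∀ K : ℕ, (V K) → Matrix (κ K) (↥(pbox (towerTorus Lc (M' K) (n + 1))) × Fin (d + 1)) ℝ)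
    (h𝔔₁ : ∀ K : ℕ, ∀ v, (Q₂₁f K) v * (Q₁₀ K) + (Q₂₀ K) * (Q₁₁f K) v = (𝔔₁f K) v)
    (𝔔₂f : ∀ K : ℕ, (V K) → (V K) → Matrix (κ K) (↥(pbox (towerTorus Lc (M' K) (n + 1))) × Fin (d + 1)) ℝ)
    (h𝔔₂ : ∀ K : ℕ, ∀ v v', (Q₂₂f K) v v' * (Q₁₀ K) + (Q₂₁f K) v * (Q₁₁f K) v' + ((Q₂₁f K) v * (Q₁₁f K) v' + (Q₂₀ K) * (Q₁₂f K) v v') = (𝔔₂f K) v v')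
    (H'₁f : ∀ K : ℕ, (V K) → Matrix (↥(pbox (towerTorus Lc (M' K) (n + 1))) × Fin (d + 1)) (↥(pbox (towerTorus Lc (M' K) (n + 1))) × Fin (d + 1)) ℝ)
    (hH'₁f : ∀ K : ℕ, ∀ v, (H'₁f K) v = -((-(c • Matrix.diagonal (fun b : (↥(pbox (towerTorus Lc (M' K) (n + 1))) × Fin (d + 1)) => (lv K) v b.1)))ᵀ * (H₀ K)) + (H₁f K) v + (H₀ K) * (-(c • Matrix.diagonal (fun b : (↥(pbox (towerTorus Lc (M' K) (n + 1))) × Fin (d + 1)) => (lv K) v b.1))))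
    (H'₂f : ∀ K : ℕ, (V K) → (V K) → Matrix (↥(pbox (towerTorus Lc (M' K) (n + 1))) × Fin (d + 1)) (↥(pbox (towerTorus Lc (M' K) (n + 1))) × Fin (d + 1)) ℝ)
    (hH'₂f : ∀ K : ℕ, ∀ v v', (H'₂f K) v v' = ((-(c • Matrix.diagonal (fun b : (↥(pbox (towerTorus Lc (M' K) (n + 1))) × Fin (d + 1)) => (lv K) v b.1))) * (-(c • Matrix.diagonal (fun b : (↥(pbox (towerTorus Lc (M' K) (n + 1))) × Fin (d + 1)) => (lv K) v' b.1))))ᵀ * (H₀ K) + (-((-(c • Matrix.diagonal (fun b : (↥(pbox (towerTorus Lc (M' K) (n + 1))) × Fin (d + 1)) => (lv K) v b.1)))ᵀ * (H₁f K) v') + -((-(c • Matrix.diagonal (fun b : (↥(pbox (towerTorus Lc (M' K) (n + 1))) × Fin (d + 1)) => (lv K) v b.1)))ᵀ * (H₀ K) * (-(c • Matrix.diagonal (fun b : (↥(pbox (towerTorus Lc (M' K) (n + 1))) × Fin (d + 1)) => (lv K) v' b.1)))))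
      + ((-((-(c • Matrix.diagonal (fun b : (↥(pbox (towerTorus Lc (M' K) (n + 1))) × Fin (d + 1)) => (lv K) v b.1)))ᵀ * (H₁f K) v') + -((-(c • Matrix.diagonal (fun b : (↥(pbox (towerTorus Lc (M' K) (n + 1))) × Fin (d + 1)) => (lv K) v b.1)))ᵀ * (H₀ K) * (-(c • Matrix.diagonal (fun b : (↥(pbox (towerTorus Lc (M' K) (n + 1))) × Fin (d + 1)) => (lv K) v' b.1))))) + ((H₂f K) v v' + (H₁f K) v * (-(c • Matrix.diagonal (fun b : (↥(pbox (towerTorus Lc (M' K) (n + 1))) × Fin (d + 1)) => (lv K) v' b.1))) + ((H₁f K) v * (-(c • Matrix.diagonal (fun b : (↥(pbox (towerTorus Lc (M' K) (n + 1))) × Fin (d + 1)) => (lv K) v' b.1))) + (H₀ K) * ((-(c • Matrix.diagonal (fun b : (↥(pbox (towerTorus Lc (M' K) (n + 1))) × Fin (d + 1)) => (lv K) v b.1))) * (-(c • Matrix.diagonal (fun b : (↥(pbox (towerTorus Lc (M' K) (n + 1))) × Fin (d + 1)) => (lv K) v' b.1))))))))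
    (𝔔'₁f : ∀ K : ℕ, (V K) → Matrix (κ K) (↥(pbox (towerTorus Lc (M' K) (n + 1))) × Fin (d + 1)) ℝ)
    (h𝔔'₁f : ∀ K : ℕ, ∀ v, (𝔔'₁f K) v = (Xbf K) v * (𝔔₀ K) + (𝔔₁f K) v + (𝔔₀ K) * (-(c • Matrix.diagonal (fun b : (↥(pbox (towerTorus Lc (M' K) (n + 1))) × Fin (d + 1)) => (lv K) v b.1))))
    (𝔔'₂f : ∀ K : ℕ, (V K) → (V K) → Matrix (κ K) (↥(pbox (towerTorus Lc (M' K) (n + 1))) × Fin (d + 1)) ℝ)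
    (h𝔔'₂f : ∀ K : ℕ, ∀ v v', (𝔔'₂f K) v v' = (Xbf K) v * (Xbf K) v' * (𝔔₀ K) + ((Xbf K) v * (𝔔₁f K) v' + (Xbf K) v * (𝔔₀ K) * (-(c • Matrix.diagonal (fun b : (↥(pbox (towerTorus Lc (M' K) (n + 1))) × Fin (d + 1)) => (lv K) v' b.1))))
      + (((Xbf K) v * (𝔔₁f K) v' + (Xbf K) v * (𝔔₀ K) * (-(c • Matrix.diagonal (fun b : (↥(pbox (towerTorus Lc (M' K) (n + 1))) × Fin (d + 1)) => (lv K) v' b.1)))) + ((𝔔₂f K) v v' + (𝔔₁f K) v * (-(c • Matrix.diagonal (fun b : (↥(pbox (towerTorus Lc (M' K) (n + 1))) × Fin (d + 1)) => (lv K) v' b.1))) + ((𝔔₁f K) v * (-(c • Matrix.diagonal (fun b : (↥(pbox (towerTorus Lc (M' K) (n + 1))) × Fin (d + 1)) => (lv K) v' b.1))) + (𝔔₀ K) * ((-(c • Matrix.diagonal (fun b : (↥(pbox (towerTorus Lc (M' K) (n + 1))) × Fin (d + 1)) => (lv K) v b.1))) * (-(c • Matrix.diagonal (fun b : (↥(pbox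 (towerTorus Lc (M' K) (n + 1))) × Fin (d + 1)) => (lv K) v' b.1))))))))
    -- #21's generator jets by their closed forms at `h := hv v` (weight `h`), per direction
    (W₁f W₂f : ∀ K : ℕ, (V K) → Matrix (↥(pbox (towerTorus Lc (M' K) (n + 1))) × Fin (d + 1)) (NParam Lc (M' K) rs (n + 1)) ℝ)
    (hW₁f : ∀ K : ℕ, ∀ v, (W₁f K) v = Matrix.of fun (b : (↥(pbox (towerTorus Lc (M' K) (n + 1))) × Fin (d + 1))) (e : (NParam Lc (M' K) rs (n + 1))) => -(c * (hv K) v b * evalN Lc (M' K) rs (n + 1) (fun b' : (↥(pbox (towerTorus Lc (M' K) (n + 1))) × Fin (d + 1)) => (b'.1 : Site (d + 1)) + unitVec b'.2) b e))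
    (hW₂f : ∀ K : ℕ, ∀ v, (W₂f K) v = Matrix.of fun (b : (↥(pbox (towerTorus Lc (M' K) (n + 1))) × Fin (d + 1))) (e : (NParam Lc (M' K) rs (n + 1))) => (c * (hv K) v b) ^ 2 * evalN Lc (M' K) rs (n + 1) (fun b' : (↥(pbox (towerTorus Lc (M' K) (n + 1))) × Fin (d + 1)) => (b'.1 : Site (d + 1)) + unitVec b'.2) b e)
    -- the (COV-m) order-1∕2 images and the (WARD-m) sources, per direction (free)
    (Db₁f Db₂f : ∀ K : ℕ, (V K) → Matrix (↥(pbox (M' K)) × Fin (d + 1)) (Res (toSite (rs 0)) Lc (M' K)) ℝ)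
    (Y₁f Y₂f : ∀ K : ℕ, (V K) → Matrix (κ K) (NParam Lc (M' K) rs (n + 1)) ℝ)
    -- the `G`-side DRESSED WORDS, NAMED (#36b's shapes at `B := [Q₁₁f v; 0]`)
    (Gw₁f : ∀ K : ℕ, (V K) → Matrix (↥(pbox (M' K)) × Fin (d + 1)) (↥(pbox (M' K)) × Fin (d + 1)) ℝ)
    (hGw₁f : ∀ K : ℕ, ∀ v, (Gw₁f K) v = (((L K) * ((H₁f K) v) - (S K) * (fromRows ((Q₁₁f K) v) (0 : Matrix (NParam Lc (fine Lc (M' K)) (fun k => rs (k + 1)) n) (↥(pbox (towerTorus Lc (M' K) (n + 1))) × Fin (d + 1)) ℝ))) * (I K) + (L K) * (fromRows ((Q₁₁f K) v) (0 : Matrix (NParam Lc (fine Lc (M' K)) (fun k => rs (k + 1)) n) (↥(pbox (towerTorus Lc (M' K) (n + 1))) × Fin (d + 1)) ℝ))ᵀ * (S K)).toBlocks₁₁)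
    (Gw₂f : ∀ K : ℕ, (V K) → (V K) → Matrix (↥(pbox (M' K)) × Fin (d + 1)) (↥(pbox (M' K)) × Fin (d + 1)) ℝ)
    (hGw₂f : ∀ K : ℕ, ∀ v v', (Gw₂f K) v v' =
      ((((-(((L K) * ((H₁f K) v) - (S K) * (fromRows ((Q₁₁f K) v) (0 : Matrix (NParam Lc (fine Lc (M' K)) (fun k => rs (k + 1)) n) (↥(pbox (towerTorus Lc (M' K) (n + 1))) × Fin (d + 1)) ℝ))) * (Γ K) - (L K) * (fromRows ((Q₁₁f K) v) (0 : Matrix (NParam Lc (fine Lc (M' K)) (fun k => rs (k + 1)) n) (↥(pbox (towerTorus Lc (M' K) (n + 1))) × Fin (d + 1)) ℝ))ᵀ * (L K)) * ((H₁f K) v') + (L K) * ((H₂f K) v v')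
          - ((((L K) * ((H₁f K) v) - (S K) * (fromRows ((Q₁₁f K) v) (0 : Matrix (NParam Lc (fine Lc (M' K)) (fun k => rs (k + 1)) n) (↥(pbox (towerTorus Lc (M' K) (n + 1))) × Fin (d + 1)) ℝ))) * (I K) + (L K) * (fromRows ((Q₁₁f K) v) (0 : Matrix (NParam Lc (fine Lc (M' K)) (fun k => rs (k + 1)) n) (↥(pbox (towerTorus Lc (M' K) (n + 1))) × Fin (d + 1)) ℝ))ᵀ * (S K)) * (fromRows ((Q₁₁f K) v') (0 : Matrix (NParam Lc (fine Lc (M' K)) (fun k => rs (k + 1)) n) (↥(pbox (towerTorus Lc (M' K) (n + 1))) × Fin (d + 1)) ℝ)) + (S K) * (fromRows ((Q₁₂f K) v v') (0 : Matrix (NParam Lc (fine Lc (M' K)) (fun k => rs (k + 1)) n) (↥(pbox (towerTorus Lc (M' K) (n + 1))) × Fin (d + 1)) ℝ)))) * (I K)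
        + ((L K) * ((H₁f K) v) - (S K) * (fromRows ((Q₁₁f K) v) (0 : Matrix (NParam Lc (fine Lc (M' K)) (fun k => rs (k + 1)) n) (↥(pbox (towerTorus Lc (M' K) (n + 1))) × Fin (d + 1)) ℝ))) * (-(((Γ K) * ((H₁f K) v') + (I K) * (fromRows ((Q₁₁f K) v') (0 : Matrix (NParam Lc (fine Lc (M' K)) (fun k => rs (k + 1)) n) (↥(pbox (towerTorus Lc (M' K) (n + 1))) × Fin (d + 1)) ℝ))) * (I K) + (Γ K) * (fromRows ((Q₁₁f K) v') (0 : Matrix (NParam Lc (fine Lc (M' K)) (fun k => rs (k + 1)) n) (↥(pbox (towerTorus Lc (M' K) (n + 1))) × Fin (d + 1)) ℝ))ᵀ * (S K))))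
      - ((-(((L K) * ((H₁f K) v) - (S K) * (fromRows ((Q₁₁f K) v) (0 : Matrix (NParam Lc (fine Lc (M' K)) (fun k => rs (k + 1)) n) (↥(pbox (towerTorus Lc (M' K) (n + 1))) × Fin (d + 1)) ℝ))) * (Γ K) - (L K) * (fromRows ((Q₁₁f K) v) (0 : Matrix (NParam Lc (fine Lc (M' K)) (fun k => rs (k + 1)) n) (↥(pbox (towerTorus Lc (M' K) (n + 1))) × Fin (d + 1)) ℝ))ᵀ * (L K)) * (-(fromRows ((Q₁₁f K) v') (0 : Matrix (NParam Lc (fine Lc (M' K)) (fun k => rs (k + 1)) n) (↥(pbox (towerTorus Lc (M' K) (n + 1))) × Fin (d + 1)) ℝ))ᵀ) + (L K) * (fromRows ((Q₁₂f K) v v') (0 : Matrix (NParam Lc (fine Lc (M' K)) (fun k => rs (k + 1)) n) (↥(pbox (towerTorus Lc (M' K) (n + 1))) × Fin (d + 1)) ℝ))ᵀ) * (S K)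
          + (L K) * (-(fromRows ((Q₁₁f K) v) (0 : Matrix (NParam Lc (fine Lc (M' K)) (fun k => rs (k + 1)) n) (↥(pbox (towerTorus Lc (M' K) (n + 1))) × Fin (d + 1)) ℝ))ᵀ) * (((L K) * ((H₁f K) v') - (S K) * (fromRows ((Q₁₁f K) v') (0 : Matrix (NParam Lc (fine Lc (M' K)) (fun k => rs (k + 1)) n) (↥(pbox (towerTorus Lc (M' K) (n + 1))) × Fin (d + 1)) ℝ))) * (I K) + (L K) * (fromRows ((Q₁₁f K) v') (0 : Matrix (NParam Lc (fine Lc (M' K)) (fun k => rs (k + 1)) n) (↥(pbox (towerTorus Lc (M' K) (n + 1))) × Fin (d + 1)) ℝ))ᵀ * (S K))))).toBlocks₁₁)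
    -- #21's ROWS, FOR EVERY DIRECTION: the coarse chart's Faddeev–Popov 2-jet, the form parities, the graded Ward rows, (COV-m) orders 1, 2 on both levels
    (uTop : ∀ K : ℕ, ∀ v, secondVar ((τ₂ K) * (Dbar K)) ((τ₂ K) * (Db₁f K) v) ((τ₂ K) * (Db₂f K) v) = 0)
    (hH₁t : ∀ K : ℕ, ∀ v, ((H₁f K) v)ᵀ = -(H₁f K) v)
    (hH₂t : ∀ K : ℕ, ∀ v, ((H₂f K) v v)ᵀ = (H₂f K) v v)
    (a1 : ∀ K : ℕ, ∀ v, (H₁f K) v * (W₀ K) + (H₀ K) * (W₁f K) v = (𝔔₀ K)ᵀ * (Y₁f K) v)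
    (a2 : ∀ K : ℕ, ∀ v, (H₂f K) v v * (W₀ K) + (2 : ℝ) • ((H₁f K) v * (W₁f K) v) + (H₀ K) * (W₂f K) v = -((2 : ℝ) • (((𝔔₁f K) v)ᵀ * (Y₁f K) v)) + (𝔔₀ K)ᵀ * (Y₂f K) v)
    (c1 : ∀ K : ℕ, ∀ v, (Q₁₁f K) v * (W₀ K) + (Q₁₀ K) * (W₁f K) v = fromCols ((Db₁f K) v) (0 : Matrix (↥(pbox (M' K)) × Fin (d + 1)) (NParam Lc (fine Lc (M' K)) (fun k => rs (k + 1)) n) ℝ))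
    (c2 : ∀ K : ℕ, ∀ v, (Q₁₂f K) v v * (W₀ K) + (2 : ℝ) • ((Q₁₁f K) v * (W₁f K) v) + (Q₁₀ K) * (W₂f K) v = fromCols ((Db₂f K) v) (0 : Matrix (↥(pbox (M' K)) × Fin (d + 1)) (NParam Lc (fine Lc (M' K)) (fun k => rs (k + 1)) n) ℝ))
    (d1 : ∀ K : ℕ, ∀ v, (Q₂₁f K) v * (Dbar K) + (Q₂₀ K) * (Db₁f K) v = 0)
    (d2 : ∀ K : ℕ, ∀ v, (Q₂₂f K) v v * (Dbar K) + (2 : ℝ) • ((Q₂₁f K) v * (Db₁f K) v) + (Q₂₀ K) * (Db₂f K) v = 0)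
    -- a finite family of direction LABELS (box-free) read in every box's direction module, and the pair bound to the base points `(μ, 0)`, `(ν, z)`
    {σ : Type*} [Fintype σ] [DecidableEq σ] (dv : ∀ K : ℕ, σ → V K) (a₁ a₂ : σ)
    -- (S3-1) N — per box: the ONE-SHOT system of depth `n+2`, right inverse and LEG over the box-free chart kernel `A_N` under the torus rules (DISPLAYED;
    -- an2's composite one-shot chart + leaf-05's sockets discharge them at the record); (P2‴)'s lattice letters of `A_N`: decay + blocking-`Lc^(n+2)` covariance
    {XN : ∀ K : ℕ, Matrix ((↥(pbox (towerTorus Lc (M' K) (n + 1))) × Fin (d + 1)) ⊕ (κ K ⊕ (NParam Lc (M' K) rs (n + 1)))) ((↥(pbox (towerTorus Lc (M' K) (n + 1))) × Fin (d + 1)) ⊕ (κ K ⊕ (NParam Lc (M' K) rs (n + 1)))) ℝ} (hXN : ∀ K : ℕ, kkt (H₀ K) (fromRows (𝔔₀ K) (P K)) * XN K = 1)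
    (ρN : Fin (d + 1) → ℤ) (LNc : ℕ) (fN : ∀ K : ℕ, κ K → Idx (towerTorus Lc (M' K) (n + 1)) (Fib d)) (hfN : ∀ K : ℕ, Function.Injective (fN K))
    (hmN : ∀ K : ℕ, ∀ a : κ K, ∃ m : Fin (d + 1), (fN K a).2 = Sum.inr m)
    (hcN : ∀ K : ℕ, ∀ (s : ↥(pbox (towerTorus Lc (M' K) (n + 1)))) (m : Fin (d + 1)), ((s, Sum.inr m) : Idx (towerTorus Lc (M' K) (n + 1)) (Fib d)) ∈ Set.range (fN K) ↔ Torus.proj LNc (s : Site (d + 1)) = 0)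
    {AN : MKer (d + 1) (Fib d)} {CAN αN : ℝ} (hAN : Decays AN CAN αN) (hαN : 0 < αN)
    (hANsh : ∀ t : Fin (d + 1) → ℤ, shiftK (((Lc ^ (n + 2) : ℕ) : ℤ) • t) AN = AN)
    (hEAN : ∀ K : ℕ, perF (towerTorus Lc (M' K) (n + 1)) (axEc ρN LNc) * perF (towerTorus Lc (M' K) (n + 1)) AN = perF (towerTorus Lc (M' K) (n + 1)) AN)
    (hAEN : ∀ K : ℕ, perF (towerTorus Lc (M' K) (n + 1)) AN * perF (towerTorus Lc (M' K) (n + 1)) (axEc ρN LNc) = perF (towerTorus Lc (M' K) (n + 1)) AN)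
    (hLN : ∀ K : ℕ, (XN K).submatrix (Sum.map id Sum.inl) (Sum.map id Sum.inl) = fromBlocks
      (Matrix.of fun (b b' : (↥(pbox (towerTorus Lc (M' K) (n + 1))) × Fin (d + 1))) =>
        axEc ρN LNc (b.1 : Site (d + 1)) (b.1 : Site (d + 1)) (Sum.inl b.2) (Sum.inl b.2)
          * (axEc ρN LNc (b'.1 : Site (d + 1)) (b'.1 : Site (d + 1)) (Sum.inl b'.2) (Sum.inl b'.2) * perF (towerTorus Lc (M' K) (n + 1)) AN (b.1, Sum.inl b.2) (b'.1, Sum.inl b'.2)))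
      (Matrix.of fun (b : (↥(pbox (towerTorus Lc (M' K) (n + 1))) × Fin (d + 1))) (a : κ K) =>
        axEc ρN LNc (b.1 : Site (d + 1)) (b.1 : Site (d + 1)) (Sum.inl b.2) (Sum.inl b.2) * perF (towerTorus Lc (M' K) (n + 1)) AN (b.1, Sum.inl b.2) ((fN K) a))
      (-Matrix.of fun (a : κ K) (b : (↥(pbox (towerTorus Lc (M' K) (n + 1))) × Fin (d + 1))) =>
        axEc ρN LNc (b.1 : Site (d + 1)) (b.1 : Site (d + 1)) (Sum.inl b.2) (Sum.inl b.2) * perF (towerTorus Lc (M' K) (n + 1)) AN ((fN K) a) (b.1, Sum.inl b.2))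
      (-((perF (towerTorus Lc (M' K) (n + 1)) AN).submatrix (fN K) (fN K))))
    -- (S3-2) N — the lattice base-point jets `𝒱_N (μ,0)`, `𝒱_N (ν,z)`, `𝒲_N (μ,0;ν,z)`: bi-localised ((P2‴)), and PER BOX their periodisations carry the
    -- parities and ARE the door's `N` jets in the directions `a₁ a₂` on the blocks (the (C1) namings — an2's — DISPLAYED)
    {pN pN' qN qN' : Fin (d + 1) → ℤ} {CvN CvN' CwN δN : ℝ}
    (hVN : BiLoc (𝒱N μ 0) pN pN' CvN δN) (hVN' : BiLoc (𝒱N ν z) qN' qN CvN' δN) (hWN : BiLoc (𝒲N μ 0 ν z) pN qN CwN δN) (hδN : 0 < δN)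
    (hVNm : ∀ K : ℕ, ∀ a a' : κ K, (perF (towerTorus Lc (M' K) (n + 1)) (dper (towerTorus Lc (M' K) (n + 1)) (𝒱N μ 0))) ((fN K) a) ((fN K) a') = 0)
    (hVNt : ∀ K : ℕ, ∀ (b : (↥(pbox (towerTorus Lc (M' K) (n + 1))) × Fin (d + 1))) (a : κ K), (perF (towerTorus Lc (M' K) (n + 1)) (dper (towerTorus Lc (M' K) (n + 1)) (𝒱N μ 0))) (b.1, Sum.inl b.2) ((fN K) a) = (perF (towerTorus Lc (M' K) (n + 1)) (dper (towerTorus Lc (M' K) (n + 1)) (𝒱N μ 0))) ((fN K) a) (b.1, Sum.inl b.2))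
    (hVN'm : ∀ K : ℕ, ∀ a a' : κ K, (perF (towerTorus Lc (M' K) (n + 1)) (dper (towerTorus Lc (M' K) (n + 1)) (𝒱N ν z))) ((fN K) a) ((fN K) a') = 0)
    (hVN't : ∀ K : ℕ, ∀ (b : (↥(pbox (towerTorus Lc (M' K) (n + 1))) × Fin (d + 1))) (a : κ K), (perF (towerTorus Lc (M' K) (n + 1)) (dper (towerTorus Lc (M' K) (n + 1)) (𝒱N ν z))) (b.1, Sum.inl b.2) ((fN K) a) = (perF (towerTorus Lc (M' K) (n + 1)) (dper (towerTorus Lc (M' K) (n + 1)) (𝒱N ν z))) ((fN K) a) (b.1, Sum.inl b.2))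
    (hWNm : ∀ K : ℕ, ∀ a a' : κ K, (perF (towerTorus Lc (M' K) (n + 1)) (dper (towerTorus Lc (M' K) (n + 1)) (𝒲N μ 0 ν z))) ((fN K) a) ((fN K) a') = 0)
    (hWNt : ∀ K : ℕ, ∀ (b : (↥(pbox (towerTorus Lc (M' K) (n + 1))) × Fin (d + 1))) (a : κ K), (perF (towerTorus Lc (M' K) (n + 1)) (dper (towerTorus Lc (M' K) (n + 1)) (𝒲N μ 0 ν z))) (b.1, Sum.inl b.2) ((fN K) a) = -(perF (towerTorus Lc (M' K) (n + 1)) (dper (towerTorus Lc (M' K) (n + 1)) (𝒲N μ 0 ν z))) ((fN K) a) (b.1, Sum.inl b.2))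
    (hHN₁ : ∀ K : ℕ, H'₁f K (dv K a₁) = (perF (towerTorus Lc (M' K) (n + 1)) (dper (towerTorus Lc (M' K) (n + 1)) (𝒱N μ 0))).submatrix (fun b : (↥(pbox (towerTorus Lc (M' K) (n + 1))) × Fin (d + 1)) => ((b.1, Sum.inl b.2) : Idx (towerTorus Lc (M' K) (n + 1)) (Fib d))) (fun b : (↥(pbox (towerTorus Lc (M' K) (n + 1))) × Fin (d + 1)) => ((b.1, Sum.inl b.2) : Idx (towerTorus Lc (M' K) (n + 1)) (Fib d))))
    (hQN₁ : ∀ K : ℕ, 𝔔'₁f K (dv K a₁) = (perF (towerTorus Lc (M' K) (n + 1)) (dper (towerTorus Lc (M' K) (n + 1)) (𝒱N μ 0))).submatrix (fN K) (fun b : (↥(pbox (towerTorus Lc (M' K) (n + 1))) × Fin (d + 1)) => ((b.1, Sum.inl b.2) : Idx (towerTorus Lc (M' K) (n + 1)) (Fib d))))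
    (hHN₁' : ∀ K : ℕ, H'₁f K (dv K a₂) = (perF (towerTorus Lc (M' K) (n + 1)) (dper (towerTorus Lc (M' K) (n + 1)) (𝒱N ν z))).submatrix (fun b : (↥(pbox (towerTorus Lc (M' K) (n + 1))) × Fin (d + 1)) => ((b.1, Sum.inl b.2) : Idx (towerTorus Lc (M' K) (n + 1)) (Fib d))) (fun b : (↥(pbox (towerTorus Lc (M' K) (n + 1))) × Fin (d + 1)) => ((b.1, Sum.inl b.2) : Idx (towerTorus Lc (M' K) (n + 1)) (Fib d))))
    (hQN₁' : ∀ K : ℕ, 𝔔'₁f K (dv K a₂) = (perF (towerTorus Lc (M' K) (n + 1)) (dper (towerTorus Lc (M' K) (n + 1)) (𝒱N ν z))).submatrix (fN K) (fun b : (↥(pbox (towerTorus Lc (M' K) (n + 1))) × Fin (d + 1)) => ((b.1, Sum.inl b.2) : Idx (towerTorus Lc (M' K) (n + 1)) (Fib d))))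
    (hHN₂ : ∀ K : ℕ, (1 / 2 : ℝ) • (H'₂f K (dv K a₁) (dv K a₂) + H'₂f K (dv K a₂) (dv K a₁)) = (perF (towerTorus Lc (M' K) (n + 1)) (dper (towerTorus Lc (M' K) (n + 1)) (𝒲N μ 0 ν z))).submatrix (fun b : (↥(pbox (towerTorus Lc (M' K) (n + 1))) × Fin (d + 1)) => ((b.1, Sum.inl b.2) : Idx (towerTorus Lc (M' K) (n + 1)) (Fib d))) (fun b : (↥(pbox (towerTorus Lc (M' K) (n + 1))) × Fin (d + 1)) => ((b.1, Sum.inl b.2) : Idx (towerTorus Lc (M' K) (n + 1)) (Fib d))))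
    (hQN₂ : ∀ K : ℕ, (1 / 2 : ℝ) • (𝔔'₂f K (dv K a₁) (dv K a₂) + 𝔔'₂f K (dv K a₂) (dv K a₁)) = (perF (towerTorus Lc (M' K) (n + 1)) (dper (towerTorus Lc (M' K) (n + 1)) (𝒲N μ 0 ν z))).submatrix (fN K) (fun b : (↥(pbox (towerTorus Lc (M' K) (n + 1))) × Fin (d + 1)) => ((b.1, Sum.inl b.2) : Idx (towerTorus Lc (M' K) (n + 1)) (Fib d))))
    -- (S3-1) F — per box: the ONE-SHOT system of the tower below (depth `n+1`, same finest torus), right inverse and LEG over `A_F` (DISPLAYED);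
    -- (P2‴)'s lattice letters of `A_F`: decay + blocking-`Lc^(n+1)` covariance
    {XF : ∀ K : ℕ, Matrix ((↥(pbox (towerTorus Lc (M' K) (n + 1))) × Fin (d + 1)) ⊕ ((↥(pbox (M' K)) × Fin (d + 1)) ⊕ (NParam Lc (fine Lc (M' K)) (fun k => rs (k + 1)) n))) ((↥(pbox (towerTorus Lc (M' K) (n + 1))) × Fin (d + 1)) ⊕ ((↥(pbox (M' K)) × Fin (d + 1)) ⊕ (NParam Lc (fine Lc (M' K)) (fun k => rs (k + 1)) n))) ℝ} (hXF : ∀ K : ℕ, kkt (H₀ K) (fromRows (Q₁₀ K) (τ₁ K)) * XF K = 1)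
    (ρF : Fin (d + 1) → ℤ) (LFc : ℕ) (fF : ∀ K : ℕ, (↥(pbox (M' K)) × Fin (d + 1)) → Idx (towerTorus Lc (M' K) (n + 1)) (Fib d)) (hfF : ∀ K : ℕ, Function.Injective (fF K))
    (hmF : ∀ K : ℕ, ∀ a : (↥(pbox (M' K)) × Fin (d + 1)), ∃ m : Fin (d + 1), (fF K a).2 = Sum.inr m)
    (hcF : ∀ K : ℕ, ∀ (s : ↥(pbox (towerTorus Lc (M' K) (n + 1)))) (m : Fin (d + 1)), ((s, Sum.inr m) : Idx (towerTorus Lc (M' K) (n + 1)) (Fib d)) ∈ Set.range (fF K) ↔ Torus.proj LFc (s : Site (d + 1)) = 0)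
    {AF : MKer (d + 1) (Fib d)} {CAF αF : ℝ} (hAF : Decays AF CAF αF) (hαF : 0 < αF)
    (hAFsh : ∀ t : Fin (d + 1) → ℤ, shiftK (((Lc ^ (n + 1) : ℕ) : ℤ) • t) AF = AF)
    (hEAF : ∀ K : ℕ, perF (towerTorus Lc (M' K) (n + 1)) (axEc ρF LFc) * perF (towerTorus Lc (M' K) (n + 1)) AF = perF (towerTorus Lc (M' K) (n + 1)) AF)
    (hAEF : ∀ K : ℕ, perF (towerTorus Lc (M' K) (n + 1)) AF * perF (towerTorus Lc (M' K) (n + 1)) (axEc ρF LFc) = perF (towerTorus Lc (M' K) (n + 1)) AF)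
    (hLF : ∀ K : ℕ, (XF K).submatrix (Sum.map id Sum.inl) (Sum.map id Sum.inl) = fromBlocks
      (Matrix.of fun (b b' : (↥(pbox (towerTorus Lc (M' K) (n + 1))) × Fin (d + 1))) =>
        axEc ρF LFc (b.1 : Site (d + 1)) (b.1 : Site (d + 1)) (Sum.inl b.2) (Sum.inl b.2)
          * (axEc ρF LFc (b'.1 : Site (d + 1)) (b'.1 : Site (d + 1)) (Sum.inl b'.2) (Sum.inl b'.2) * perF (towerTorus Lc (M' K) (n + 1)) AF (b.1, Sum.inl b.2) (b'.1, Sum.inl b'.2)))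
      (Matrix.of fun (b : (↥(pbox (towerTorus Lc (M' K) (n + 1))) × Fin (d + 1))) (a : (↥(pbox (M' K)) × Fin (d + 1))) =>
        axEc ρF LFc (b.1 : Site (d + 1)) (b.1 : Site (d + 1)) (Sum.inl b.2) (Sum.inl b.2) * perF (towerTorus Lc (M' K) (n + 1)) AF (b.1, Sum.inl b.2) ((fF K) a))
      (-Matrix.of fun (a : (↥(pbox (M' K)) × Fin (d + 1))) (b : (↥(pbox (towerTorus Lc (M' K) (n + 1))) × Fin (d + 1))) =>
        axEc ρF LFc (b.1 : Site (d + 1)) (b.1 : Site (d + 1)) (Sum.inl b.2) (Sum.inl b.2) * perF (towerTorus Lc (M' K) (n + 1)) AF ((fF K) a) (b.1, Sum.inl b.2))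
      (-((perF (towerTorus Lc (M' K) (n + 1)) AF).submatrix (fF K) (fF K))))
    -- (S3-2) F — the lattice base-point jets of the tower below: bi-localised, and PER BOX their periodisations ARE the door's fine jets in the directions `a₁ a₂`
    {pF pF' qF qF' : Fin (d + 1) → ℤ} {CvF CvF' CwF δF : ℝ}
    (hVF : BiLoc (𝒱F μ 0) pF pF' CvF δF) (hVF' : BiLoc (𝒱F ν z) qF' qF CvF' δF) (hWF : BiLoc (𝒲F μ 0 ν z) pF qF CwF δF) (hδF : 0 < δF)
    (hVFm : ∀ K : ℕ, ∀ a a' : (↥(pbox (M' K)) × Fin (d + 1)), (perF (towerTorus Lc (M' K) (n + 1)) (dper (towerTorus Lc (M' K) (n + 1)) (𝒱F μ 0))) ((fF K) a) ((fF K) a') = 0)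
    (hVFt : ∀ K : ℕ, ∀ (b : (↥(pbox (towerTorus Lc (M' K) (n + 1))) × Fin (d + 1))) (a : (↥(pbox (M' K)) × Fin (d + 1))), (perF (towerTorus Lc (M' K) (n + 1)) (dper (towerTorus Lc (M' K) (n + 1)) (𝒱F μ 0))) (b.1, Sum.inl b.2) ((fF K) a) = (perF (towerTorus Lc (M' K) (n + 1)) (dper (towerTorus Lc (M' K) (n + 1)) (𝒱F μ 0))) ((fF K) a) (b.1, Sum.inl b.2))
    (hVF'm : ∀ K : ℕ, ∀ a a' : (↥(pbox (M' K)) × Fin (d + 1)), (perF (towerTorus Lc (M' K) (n + 1)) (dper (towerTorus Lc (M' K) (n + 1)) (𝒱F ν z))) ((fF K) a) ((fF K) a') = 0)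
    (hVF't : ∀ K : ℕ, ∀ (b : (↥(pbox (towerTorus Lc (M' K) (n + 1))) × Fin (d + 1))) (a : (↥(pbox (M' K)) × Fin (d + 1))), (perF (towerTorus Lc (M' K) (n + 1)) (dper (towerTorus Lc (M' K) (n + 1)) (𝒱F ν z))) (b.1, Sum.inl b.2) ((fF K) a) = (perF (towerTorus Lc (M' K) (n + 1)) (dper (towerTorus Lc (M' K) (n + 1)) (𝒱F ν z))) ((fF K) a) (b.1, Sum.inl b.2))
    (hWFm : ∀ K : ℕ, ∀ a a' : (↥(pbox (M' K)) × Fin (d + 1)), (perF (towerTorus Lc (M' K) (n + 1)) (dper (towerTorus Lc (M' K) (n + 1)) (𝒲F μ 0 ν z))) ((fF K) a) ((fF K) a') = 0)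
    (hWFt : ∀ K : ℕ, ∀ (b : (↥(pbox (towerTorus Lc (M' K) (n + 1))) × Fin (d + 1))) (a : (↥(pbox (M' K)) × Fin (d + 1))), (perF (towerTorus Lc (M' K) (n + 1)) (dper (towerTorus Lc (M' K) (n + 1)) (𝒲F μ 0 ν z))) (b.1, Sum.inl b.2) ((fF K) a) = -(perF (towerTorus Lc (M' K) (n + 1)) (dper (towerTorus Lc (M' K) (n + 1)) (𝒲F μ 0 ν z))) ((fF K) a) (b.1, Sum.inl b.2))
    (hHF₁ : ∀ K : ℕ, H₁f K (dv K a₁) = (perF (towerTorus Lc (M' K) (n + 1)) (dper (towerTorus Lc (M' K) (n + 1)) (𝒱F μ 0))).submatrix (fun b : (↥(pbox (towerTorus Lc (M' K) (n + 1))) × Fin (d + 1)) => ((b.1, Sum.inl b.2) : Idx (towerTorus Lc (M' K) (n + 1)) (Fib d))) (fun b : (↥(pbox (towerTorus Lc (M' K) (n + 1))) × Fin (d + 1)) => ((b.1, Sum.inl b.2) : Idx (towerTorus Lc (M' K) (n + 1)) (Fib d))))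
    (hQF₁ : ∀ K : ℕ, Q₁₁f K (dv K a₁) = (perF (towerTorus Lc (M' K) (n + 1)) (dper (towerTorus Lc (M' K) (n + 1)) (𝒱F μ 0))).submatrix (fF K) (fun b : (↥(pbox (towerTorus Lc (M' K) (n + 1))) × Fin (d + 1)) => ((b.1, Sum.inl b.2) : Idx (towerTorus Lc (M' K) (n + 1)) (Fib d))))
    (hHF₁' : ∀ K : ℕ, H₁f K (dv K a₂) = (perF (towerTorus Lc (M' K) (n + 1)) (dper (towerTorus Lc (M' K) (n + 1)) (𝒱F ν z))).submatrix (fun b : (↥(pbox (towerTorus Lc (M' K) (n + 1))) × Fin (d + 1)) => ((b.1, Sum.inl b.2) : Idx (towerTorus Lc (M' K) (n + 1)) (Fib d))) (fun b : (↥(pbox (towerTorus Lc (M' K) (n + 1))) × Fin (d + 1)) => ((b.1, Sum.inl b.2) : Idx (towerTorus Lc (M' K) (n + 1)) (Fib d))))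
    (hQF₁' : ∀ K : ℕ, Q₁₁f K (dv K a₂) = (perF (towerTorus Lc (M' K) (n + 1)) (dper (towerTorus Lc (M' K) (n + 1)) (𝒱F ν z))).submatrix (fF K) (fun b : (↥(pbox (towerTorus Lc (M' K) (n + 1))) × Fin (d + 1)) => ((b.1, Sum.inl b.2) : Idx (towerTorus Lc (M' K) (n + 1)) (Fib d))))
    (hHF₂ : ∀ K : ℕ, (1 / 2 : ℝ) • (H₂f K (dv K a₁) (dv K a₂) + H₂f K (dv K a₂) (dv K a₁)) = (perF (towerTorus Lc (M' K) (n + 1)) (dper (towerTorus Lc (M' K) (n + 1)) (𝒲F μ 0 ν z))).submatrix (fun b : (↥(pbox (towerTorus Lc (M' K) (n + 1))) × Fin (d + 1)) => ((b.1, Sum.inl b.2) : Idx (towerTorus Lc (M' K) (n + 1)) (Fib d))) (fun b : (↥(pbox (towerTorus Lc (M' K) (n + 1))) × Fin (d + 1)) => ((b.1, Sum.inl b.2) : Idx (towerTorus Lc (M' K) (n + 1)) (Fib d))))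
    (hQF₂ : ∀ K : ℕ, (1 / 2 : ℝ) • (Q₁₂f K (dv K a₁) (dv K a₂) + Q₁₂f K (dv K a₂) (dv K a₁)) = (perF (towerTorus Lc (M' K) (n + 1)) (dper (towerTorus Lc (M' K) (n + 1)) (𝒲F μ 0 ν z))).submatrix (fF K) (fun b : (↥(pbox (towerTorus Lc (M' K) (n + 1))) × Fin (d + 1)) => ((b.1, Sum.inl b.2) : Idx (towerTorus Lc (M' K) (n + 1)) (Fib d))))
    -- (S3-2) G — the lattice base-point jets of the TOP STEP (chart kernel `Π̂ᵀ(KInvStep Lc (lev 0))Π̂` rooted at `rs 0`, whose decay and blocking-`Lc`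
    -- covariance are an2's theorems — discharged inside leaf-06's §3): bi-localised, and PER BOX their periodisations on `M′ K` ARE the door's `G` jets, the
    -- H-blocks CARRYING THE UNIT `∏_{i<n+1} wVH d Lc (lev i)` (#41d)
    {pG pG' qG qG' : Fin (d + 1) → ℤ} {CvG CvG' CwG δG : ℝ}
    (hVG : BiLoc (𝒱G μ 0) pG pG' CvG δG) (hVG' : BiLoc (𝒱G ν z) qG' qG CvG' δG) (hWG : BiLoc (𝒲G μ 0 ν z) pG qG CwG δG) (hδG : 0 < δG)
    (hVGm : ∀ K : ℕ, ∀ a a' : κ K, (perF (M' K) (dper (M' K) (𝒱G μ 0))) ((fun a : κ K => ((pμ' K a, Sum.inr (mμ' K a)) : Idx (M' K) (Fib d))) a) ((fun a : κ K => ((pμ' K a, Sum.inr (mμ' K a)) : Idx (M' K) (Fib d))) a') = 0)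
    (hVGt : ∀ K : ℕ, ∀ (b : (↥(pbox (M' K)) × Fin (d + 1))) (a : κ K), (perF (M' K) (dper (M' K) (𝒱G μ 0))) (b.1, Sum.inl b.2) ((fun a : κ K => ((pμ' K a, Sum.inr (mμ' K a)) : Idx (M' K) (Fib d))) a) = (perF (M' K) (dper (M' K) (𝒱G μ 0))) ((fun a : κ K => ((pμ' K a, Sum.inr (mμ' K a)) : Idx (M' K) (Fib d))) a) (b.1, Sum.inl b.2))
    (hVG'm : ∀ K : ℕ, ∀ a a' : κ K, (perF (M' K) (dper (M' K) (𝒱G ν z))) ((fun a : κ K => ((pμ' K a, Sum.inr (mμ' K a)) : Idx (M' K) (Fib d))) a) ((fun a : κ K => ((pμ' K a, Sum.inr (mμ' K a)) : Idx (M' K) (Fib d))) a') = 0)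
    (hVG't : ∀ K : ℕ, ∀ (b : (↥(pbox (M' K)) × Fin (d + 1))) (a : κ K), (perF (M' K) (dper (M' K) (𝒱G ν z))) (b.1, Sum.inl b.2) ((fun a : κ K => ((pμ' K a, Sum.inr (mμ' K a)) : Idx (M' K) (Fib d))) a) = (perF (M' K) (dper (M' K) (𝒱G ν z))) ((fun a : κ K => ((pμ' K a, Sum.inr (mμ' K a)) : Idx (M' K) (Fib d))) a) (b.1, Sum.inl b.2))
    (hWGm : ∀ K : ℕ, ∀ a a' : κ K, (perF (M' K) (dper (M' K) (𝒲G μ 0 ν z))) ((fun a : κ K => ((pμ' K a, Sum.inr (mμ' K a)) : Idx (M' K) (Fib d))) a) ((fun a : κ K => ((pμ' K a, Sum.inr (mμ' K a)) : Idx (M' K) (Fib d))) a') = 0)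
    (hWGt : ∀ K : ℕ, ∀ (b : (↥(pbox (M' K)) × Fin (d + 1))) (a : κ K), (perF (M' K) (dper (M' K) (𝒲G μ 0 ν z))) (b.1, Sum.inl b.2) ((fun a : κ K => ((pμ' K a, Sum.inr (mμ' K a)) : Idx (M' K) (Fib d))) a) = -(perF (M' K) (dper (M' K) (𝒲G μ 0 ν z))) ((fun a : κ K => ((pμ' K a, Sum.inr (mμ' K a)) : Idx (M' K) (Fib d))) a) (b.1, Sum.inl b.2))
    (hHG₁ : ∀ K : ℕ, (∏ i ∈ range (n + 1), wVH d Lc (lev i)) • Gw₁f K (dv K a₁) = (perF (M' K) (dper (M' K) (𝒱G μ 0))).submatrix (fun b : (↥(pbox (M' K)) × Fin (d + 1)) => ((b.1, Sum.inl b.2) : Idx (M' K) (Fib d))) (fun b : (↥(pbox (M' K)) × Fin (d + 1)) => ((b.1, Sum.inl b.2) : Idx (M' K) (Fib d))))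
    (hQG₁ : ∀ K : ℕ, Q₂₁f K (dv K a₁) = (perF (M' K) (dper (M' K) (𝒱G μ 0))).submatrix (fun a : κ K => ((pμ' K a, Sum.inr (mμ' K a)) : Idx (M' K) (Fib d))) (fun b : (↥(pbox (M' K)) × Fin (d + 1)) => ((b.1, Sum.inl b.2) : Idx (M' K) (Fib d))))
    (hHG₁' : ∀ K : ℕ, (∏ i ∈ range (n + 1), wVH d Lc (lev i)) • Gw₁f K (dv K a₂) = (perF (M' K) (dper (M' K) (𝒱G ν z))).submatrix (fun b : (↥(pbox (M' K)) × Fin (d + 1)) => ((b.1, Sum.inl b.2) : Idx (M' K) (Fib d))) (fun b : (↥(pbox (M' K)) × Fin (d + 1)) => ((b.1, Sum.inl b.2) : Idx (M' K) (Fib d))))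
    (hQG₁' : ∀ K : ℕ, Q₂₁f K (dv K a₂) = (perF (M' K) (dper (M' K) (𝒱G ν z))).submatrix (fun a : κ K => ((pμ' K a, Sum.inr (mμ' K a)) : Idx (M' K) (Fib d))) (fun b : (↥(pbox (M' K)) × Fin (d + 1)) => ((b.1, Sum.inl b.2) : Idx (M' K) (Fib d))))
    (hHG₂ : ∀ K : ℕ, (∏ i ∈ range (n + 1), wVH d Lc (lev i)) • ((1 / 2 : ℝ) • (Gw₂f K (dv K a₁) (dv K a₂) + Gw₂f K (dv K a₂) (dv K a₁))) = (perF (M' K) (dper (M' K) (𝒲G μ 0 ν z))).submatrix (fun b : (↥(pbox (M' K)) × Fin (d + 1)) => ((b.1, Sum.inl b.2) : Idx (M' K) (Fib d))) (fun b : (↥(pbox (M' K)) × Fin (d + 1)) => ((b.1, Sum.inl b.2) : Idx (M' K) (Fib d))))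
    (hQG₂ : ∀ K : ℕ, (1 / 2 : ℝ) • (Q₂₂f K (dv K a₁) (dv K a₂) + Q₂₂f K (dv K a₂) (dv K a₁)) = (perF (M' K) (dper (M' K) (𝒲G μ 0 ν z))).submatrix (fun a : κ K => ((pμ' K a, Sum.inr (mμ' K a)) : Idx (M' K) (Fib d))) (fun b : (↥(pbox (M' K)) × Fin (d + 1)) => ((b.1, Sum.inl b.2) : Idx (M' K) (Fib d))))
    : hessKer AN 𝒱N 𝒲N μ ν z
      = hessKer AF 𝒱F 𝒲F μ ν z + hessKer (coDressKBmAt (toSite (rs 0)) Lc (KInvStep (d := d) Lc (lev 0))) 𝒱G 𝒲G μ ν z :=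
  hessKer_law_of_tower_hessT_law_coDress Lc M' hM'gr hM' n (hrs 0) (lev 0) 𝒱N 𝒱F 𝒱G 𝒲N 𝒲F 𝒲G μ ν z
    hAN hαN hANsh hVN hVN' hWN hδN hAF hαF hAFsh hVF hVF' hWF hδF hVG hVG' hWG hδG
    fun K => hessT_fullIndex_law_tower (M' K) Lc lev rs n (hrs := hrs) (hlev := hlev) (hM' := hM' K) (pμ' := pμ' K) (mμ' := mμ' K) (hfμ' := hfμ' K) (hcoarse' := hcoarse' K) (hH₀ := hH₀ K) (hQ₁₀ := hQ₁₀ K) (hτ₁ := hτ₁ K) (hτ₂ := hτ₂ K) (hQ₂₀ := hQ₂₀ K) (hW₀ := hW₀ K) (hP := hP K) (c := c) (hDbar := hDbar K) (hΓ := hΓ K) (hI := hI K) (hL := hL K) (hS := hS K) (h𝔔₀ := h𝔔₀ K) (hv := hv K) (lv := lv K) (hlv := hlv K) (Xbf := Xbf K) (hXbf := hXbf K) (H₁f := H₁f K) (hH₁l := hH₁l K) (Q₁₁f := Q₁₁f K) (hQ₁₁l := hQ₁₁l K) (Q₂₁f := Q₂₁f K) (hQ₂₁l := hQ₂₁l K)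 (H₂f := H₂f K) (hH₂l := hH₂l K) (hH₂r := hH₂r K) (Q₁₂f := Q₁₂f K) (hQ₁₂l := hQ₁₂l K) (hQ₁₂r := hQ₁₂r K) (Q₂₂f := Q₂₂f K) (hQ₂₂l := hQ₂₂l K) (hQ₂₂r := hQ₂₂r K) (𝔔₁f := 𝔔₁f K) (h𝔔₁ := h𝔔₁ K) (𝔔₂f := 𝔔₂f K) (h𝔔₂ := h𝔔₂ K) (H'₁f := H'₁f K) (hH'₁f := hH'₁f K) (H'₂f := H'₂f K) (hH'₂f := hH'₂f K) (𝔔'₁f := 𝔔'₁f K) (h𝔔'₁f := h𝔔'₁f K) (𝔔'₂f := 𝔔'₂f K) (h𝔔'₂f := h𝔔'₂f K) (W₁f := W₁f K) (W₂f := W₂f K) (hW₁f := hW₁f K) (hW₂f := hW₂f K) (Db₁f := Db₁f K) (Db₂f := Db₂f K) (Y₁f := Y₁f K) (Y₂f := Y₂f K) (Gw₁f := Gw₁f K) (hGw₁f := hGw₁f K) (Gw₂f := Gw₂f K) (hGw₂f := hGw₂f K) (uTop := uTop K) (hH₁t := hH₁t K) (hH₂t := hH₂t K) (a1 := a1 K)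 (a2 := a2 K) (c1 := c1 K) (c2 := c2 K) (d1 := d1 K) (d2 := d2 K) (dv := dv K) (k := a₁) (l := a₂) (hXN := hXN K) (ρN := ρN) (LNc := LNc) (fN := fN K) (hfN := hfN K) (hmN := hmN K) (hcN := hcN K) (hEAN := hEAN K) (hAEN := hAEN K) (hLN := hLN K) (VN := (perF (towerTorus Lc (M' K) (n + 1)) (dper (towerTorus Lc (M' K) (n + 1)) (𝒱N μ 0)))) (VN' := (perF (towerTorus Lc (M' K) (n + 1)) (dper (towerTorus Lc (M' K) (n + 1)) (𝒱N ν z)))) (WN := (perF (towerTorus Lc (M' K) (n + 1)) (dper (towerTorus Lc (M' K) (n + 1)) (𝒲N μ 0 ν z)))) (hVNm := hVNm K) (hVNt := hVNt K) (hVN'm := hVN'm K) (hVN't := hVN't K) (hWNm := hWNm K) (hWNt := hWNt K) (hHN₁ := hHN₁ K) (hQN₁ := hQN₁ K) (hHN₁' := hHN₁' K) (hQN₁' := hQN₁' K) (hHN₂ := hHN₂ K) (hQN₂ := hQN₂ K) (hXF := hXF K) (ρF := ρF) (LFc := LFc) (fF := fF K) (hfF := hfF K) (hmF := hmF K) (hcF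 := hcF K) (hEAF := hEAF K) (hAEF := hAEF K) (hLF := hLF K) (VF := (perF (towerTorus Lc (M' K) (n + 1)) (dper (towerTorus Lc (M' K) (n + 1)) (𝒱F μ 0)))) (VF' := (perF (towerTorus Lc (M' K) (n + 1)) (dper (towerTorus Lc (M' K) (n + 1)) (𝒱F ν z)))) (WF := (perF (towerTorus Lc (M' K) (n + 1)) (dper (towerTorus Lc (M' K) (n + 1)) (𝒲F μ 0 ν z)))) (hVFm := hVFm K) (hVFt := hVFt K) (hVF'm := hVF'm K) (hVF't := hVF't K) (hWFm := hWFm K) (hWFt := hWFt K) (hHF₁ := hHF₁ K) (hQF₁ := hQF₁ K) (hHF₁' := hHF₁' K) (hQF₁' := hQF₁' K) (hHF₂ := hHF₂ K) (hQF₂ := hQF₂ K) (VG := (perF (M' K) (dper (M' K) (𝒱G μ 0)))) (VG' := (perF (M' K) (dper (M' K) (𝒱G ν z)))) (WG := (perF (M' K) (dper (M' K) (𝒲G μ 0 ν z)))) (hVGm := hVGm K) (hVGt := hVGt K) (hVG'm := hVG'm K) (hVG't := hVG't K) (hWGm := hWGm K) (hWGt := hWGt K) (hHG₁ := hHG₁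 K) (hQG₁ := hQG₁ K) (hHG₁' := hHG₁' K) (hQG₁' := hQG₁' K) (hHG₂ := hHG₂ K) (hQG₂ := hQG₂ K)

end Law

end Summit.QuantumFields.BalabanUV.Beta.FP.TowerKernelLaw

end
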